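import Summits.Ventures.YMGap.RobustBall.SpecificationConcentration
import HarnessLib

/-!
# Venture YMGap, track ROBUST-BALL — GAUSSIAN CONCENTRATION, step 1b: variance proxies, every Gibbs measure about the
# conditional mean, and about the mean given boundary closeness / in the infinite-volume limit (generic)

HONEST FRAMING. WHAT THIS IS: a venture file (cell `pub-ymgap`, track Y2 ROBUST-BALL, seat ds-3, theorems only), the
second half of the generic engine of the concentration currency C-CONC (`SpecificationConcentration.lean` has the
McDiarmid–Azuma bound for the KERNELS of any specification `γ` from single-site boundary influences `c`). Here, with a
VARIANCE PROXY `V ≥ Σ_{y ∈ Λ₀} c_y²` (so that bounds are monotone in the volume):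

* kernels: `f − ∫ f dγ_{Λ₀}(·|ω)` is sub-Gaussian with proxy `V/4`, tails `exp(−2 r² / V)` (`hasSubgaussianMGF_kernel_of_le`,
  `measureReal_kernel_ge_le_of_le`, `measureReal_kernel_le_le_of_le`);
* EVERY Gibbs measure `μ ∈ 𝒢(γ)` (no uniqueness): `μ{σ : f σ − ∫ f dγ_{Λ₀}(·|σ) ≥ r} ≤ exp(−2 r² / V)`
  (`measureReal_ge_kernel_integral_le`, lower tail `measureReal_le_kernel_integral_le`) — the DLR equation `μ = μ γ_{Λ₀}`
  and properness (the conditional mean is a.s. constant under each kernel);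
* given boundary closeness `|∫ f dγ_{Λ₀}(·|ω) − ∫ f dμ| ≤ ε` for all `ω` (the cell's boundary-decay currency in the
  uniqueness regime): `μ{f − ∫ f dμ ≥ r + ε} ≤ exp(−2 r² / V)`, lower tail, and `μ{|f − ∫ f dμ| ≥ r + ε} ≤ 2 exp(−2 r² / V)`
  (`measureReal_ge_integral_add_le`, `measureReal_le_integral_add_le`, `measureReal_abs_sub_integral_ge_le`);
* INFINITE-VOLUME FORM (`measureReal_abs_sub_integral_ge_le_of_tendsto`): along any sequence of volumes `Λ n` whose
  kernels approach `μ` on `f` uniformly in the boundary condition (`ε n → 0`) with proxies `Σ_{y ∈ Λ n} c_y² ≤ V`: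
  `μ{|f − ∫ f dμ| ≥ r} ≤ 2 exp(−2 r² / V)` for every `r ≥ 0`.

WHAT THIS IS NOT: a large-deviation principle or a CLT (Gaussian UPPER bound only); nothing gauge-specific; nothing
about the continuum limit or the Clay Millennium problem.

References: C. McDiarmid, Surveys in Combinatorics 1989, Lemma (1.2); C. Külske, Comm. Math. Phys. 239 (2003)
29–51, Thm. 1; H.-O. Georgii, *Gibbs Measures and Phase Transitions* (2011), Def. 1.23 / Remark 1.24.
-/

noncomputable section

open MeasureTheory ProbabilityTheory Filter Function Real
open scoped ENNReal NNReal Topology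

namespace Summit.Ventures.YMGap.RobustBall

namespace SpecConcentration

open Literature.Probability.LatticeModels
open Literature.Probability.LatticeModels.DobrushinMetric (integrable_of_abs_le')

variable {V S : Type*} [MeasurableSpace S] {γ : Specification V S}

/-! ### Kernels with a variance proxy `Vc ≥ Σ c_y²` -/

/-- **Sub-Gaussian kernels with a variance proxy**: if `Σ_{y ∈ Λ₀} c_y² ≤ Vc` then `f − ∫ f dγ_{Λ₀}(·|ω)` has a sub-Gaussian
moment generating function with parameter `Vc/4` under `γ_{Λ₀}(·|ω)` (from `integral_exp_mul_kernel_le`). [folklore] -/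
theorem hasSubgaussianMGF_kernel_of_le (hγ : IsSpecification γ) (Λ₀ : Finset V) {f : (V → S) → ℝ}
    (hfm : Measurable f) {M : ℝ} (hM : ∀ σ, |f σ| ≤ M) {c : V → ℝ} (hc0 : ∀ y, 0 ≤ c y)
    (hc : ∀ Λ', Λ' ⊆ Λ₀ → ∀ y ∈ Λ₀, y ∉ Λ' → ∀ ω η : V → S, (∀ z, z ≠ y → ω z = η z) →
      |(∫ σ, f σ ∂(γ Λ' ω)) - ∫ σ, f σ ∂(γ Λ' η)| ≤ c y)
    {Vc : ℝ} (hV : ∑ y ∈ Λ₀, c y ^ 2 ≤ Vc) (ω : V → S) :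
    HasSubgaussianMGF (fun σ => f σ - ∫ τ, f τ ∂(γ Λ₀ ω)) (Vc / 4).toNNReal (γ Λ₀ ω) := by
  haveI : IsProbabilityMeasure (γ Λ₀ ω) := hγ.isProbability _ ω
  have hV0 : 0 ≤ Vc := (Finset.sum_nonneg fun y _ => sq_nonneg (c y)).trans hV
  set m : ℝ := ∫ τ, f τ ∂(γ Λ₀ ω) with hm
  have hcm : ∀ t : ℝ, Measurable fun σ => exp (t * (f σ - m)) := fun t =>
    measurable_exp.comp (measurable_const.mul (hfm.sub measurable_const))
  have hcB : ∀ t : ℝ, ∀ σ, |exp (t * (f σ - m))| ≤ exp (|t| * (M + |m|)) := fun t σ => by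
    rw [abs_of_pos (exp_pos _), exp_le_exp]
    calc t * (f σ - m) ≤ |t * (f σ - m)| := le_abs_self _
      _ = |t| * |f σ - m| := abs_mul _ _
      _ ≤ |t| * (M + |m|) := mul_le_mul_of_nonneg_left
          ((abs_sub _ _).trans (add_le_add (hM σ) le_rfl)) (abs_nonneg _)
  refine ⟨fun t => integrable_of_abs_le' (hcm t) (hcB t), fun t => ?_⟩
  simp only [mgf]
  rw [Real.coe_toNNReal _ (by positivity)]
  have key := integral_exp_mul_kernel_le hγ Λ₀ hfm hM hc0 hc t ω
  have e : ∀ σ, exp (t * (f σ - m)) = exp (-(t * m)) * exp (t * f σ) := fun σ => by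
    rw [← exp_add]; ring_nf
  have hmono : t * m + t ^ 2 * (∑ y ∈ Λ₀, c y ^ 2) / 8 ≤ t * m + t ^ 2 * Vc / 8 := by
    have := mul_le_mul_of_nonneg_left hV (sq_nonneg t)
    linarith
  calc ∫ σ, exp (t * (f σ - m)) ∂(γ Λ₀ ω) = exp (-(t * m)) * ∫ σ, exp (t * f σ) ∂(γ Λ₀ ω) := by
        simp_rw [e]; exact integral_const_mul _ _
    _ ≤ exp (-(t * m)) * exp (t * m + t ^ 2 * Vc / 8) :=
        mul_le_mul_of_nonneg_left (key.trans (exp_le_exp.2 hmono)) (exp_pos _).le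
    _ = exp (Vc / 4 * t ^ 2 / 2) := by
        rw [← exp_add]; ring_nf

/-- **McDiarmid's inequality with a variance proxy**, upper tail: `γ_{Λ₀}({f − ∫ f dγ_{Λ₀}(·|ω) ≥ r} | ω) ≤ exp(−2 r²/Vc)`
for `Σ_{y ∈ Λ₀} c_y² ≤ Vc`, `r ≥ 0`. [folklore] -/
theorem measureReal_kernel_ge_le_of_le (hγ : IsSpecification γ) (Λ₀ : Finset V) {f : (V → S) → ℝ}
    (hfm : Measurable f) {M : ℝ} (hM : ∀ σ, |f σ| ≤ M) {c : V → ℝ} (hc0 : ∀ y, 0 ≤ c y)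
    (hc : ∀ Λ', Λ' ⊆ Λ₀ → ∀ y ∈ Λ₀, y ∉ Λ' → ∀ ω η : V → S, (∀ z, z ≠ y → ω z = η z) →
      |(∫ σ, f σ ∂(γ Λ' ω)) - ∫ σ, f σ ∂(γ Λ' η)| ≤ c y)
    {Vc : ℝ} (hV : ∑ y ∈ Λ₀, c y ^ 2 ≤ Vc) {r : ℝ} (hr : 0 ≤ r) (ω : V → S) :
    (γ Λ₀ ω).real {σ | r ≤ f σ - ∫ τ, f τ ∂(γ Λ₀ ω)} ≤ exp (-2 * r ^ 2 / Vc) := by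
  haveI : IsProbabilityMeasure (γ Λ₀ ω) := hγ.isProbability _ ω
  have hV0 : 0 ≤ Vc := (Finset.sum_nonneg fun y _ => sq_nonneg (c y)).trans hV
  have h := (hasSubgaussianMGF_kernel_of_le hγ Λ₀ hfm hM hc0 hc hV ω).measure_ge_le hr
  rw [Real.coe_toNNReal _ (by positivity)] at h
  refine h.trans (le_of_eq ?_)
  congr 1
  ring

/-- **Lower tail with a variance proxy**: `γ_{Λ₀}({∫ f dγ_{Λ₀}(·|ω) − f ≥ r} | ω) ≤ exp(−2 r² / Vc)`. [folklore] -/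
theorem measureReal_kernel_le_le_of_le (hγ : IsSpecification γ) (Λ₀ : Finset V) {f : (V → S) → ℝ}
    (hfm : Measurable f) {M : ℝ} (hM : ∀ σ, |f σ| ≤ M) {c : V → ℝ} (hc0 : ∀ y, 0 ≤ c y)
    (hc : ∀ Λ', Λ' ⊆ Λ₀ → ∀ y ∈ Λ₀, y ∉ Λ' → ∀ ω η : V → S, (∀ z, z ≠ y → ω z = η z) →
      |(∫ σ, f σ ∂(γ Λ' ω)) - ∫ σ, f σ ∂(γ Λ' η)| ≤ c y)
    {Vc : ℝ} (hV : ∑ y ∈ Λ₀, c y ^ 2 ≤ Vc) {r : ℝ} (hr : 0 ≤ r) (ω : V → S) :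
    (γ Λ₀ ω).real {σ | r ≤ (∫ τ, f τ ∂(γ Λ₀ ω)) - f σ} ≤ exp (-2 * r ^ 2 / Vc) := by
  have hc' : ∀ Λ', Λ' ⊆ Λ₀ → ∀ y ∈ Λ₀, y ∉ Λ' → ∀ ω η : V → S, (∀ z, z ≠ y → ω z = η z) →
      |(∫ σ, (-f σ) ∂(γ Λ' ω)) - ∫ σ, (-f σ) ∂(γ Λ' η)| ≤ c y := by
    intro Λ' hΛ' y hy hy' ω η hωη
    rw [integral_neg, integral_neg, ← abs_neg]
    convert hc Λ' hΛ' y hy hy' ω η hωη using 2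
    ring
  have h := measureReal_kernel_ge_le_of_le hγ Λ₀ hfm.neg (fun σ => by rw [Pi.neg_apply, abs_neg]; exact hM σ)
    hc0 hc' hV hr ω
  refine le_trans (le_of_eq ?_) h
  congr 1
  ext σ
  simp only [Set.mem_setOf_eq, Pi.neg_apply, integral_neg]
  constructor <;> intro h' <;> linarith

/-! ### Gibbs measures: concentration about the conditional mean -/

/-- **Gaussian concentration about the conditional expectation, for EVERY Gibbs measure** (Külske 2003, Thm. 1,
the step "integrate the kernel bound against `μ`"): if `μ ∈ 𝒢(γ)` then, under the hypotheses of
`integral_exp_mul_kernel_le` and `Σ_{y ∈ Λ₀} c_y² ≤ Vc`, `μ{σ : f σ − ∫ f dγ_{Λ₀}(·|σ) ≥ r} ≤ exp(−2 r² / Vc)` for `r ≥ 0` —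
by the DLR equation `μ = μ γ_{Λ₀}` and properness (`∫ f dγ_{Λ₀}(·|σ)` is a.s. constant under each kernel). No
uniqueness is assumed. [folklore] -/
theorem measureReal_ge_kernel_integral_le (hγ : IsSpecification γ) (Λ₀ : Finset V) {f : (V → S) → ℝ}
    (hfm : Measurable f) {M : ℝ} (hM : ∀ σ, |f σ| ≤ M) {c : V → ℝ} (hc0 : ∀ y, 0 ≤ c y)
    (hc : ∀ Λ', Λ' ⊆ Λ₀ → ∀ y ∈ Λ₀, y ∉ Λ' → ∀ ω η : V → S, (∀ z, z ≠ y → ω z = η z) →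
      |(∫ σ, f σ ∂(γ Λ' ω)) - ∫ σ, f σ ∂(γ Λ' η)| ≤ c y)
    {Vc : ℝ} (hV : ∑ y ∈ Λ₀, c y ^ 2 ≤ Vc)
    {μ : Measure (V → S)} (hμ : IsGibbsMeasure γ μ) {r : ℝ} (hr : 0 ≤ r) :
    μ.real {σ | r ≤ f σ - ∫ τ, f τ ∂(γ Λ₀ σ)} ≤ exp (-2 * r ^ 2 / Vc) := by
  haveI := hμ.isProbabilityMeasure
  set g : (V → S) → ℝ := fun σ => ∫ τ, f τ ∂(γ Λ₀ σ) with hg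
  have hgm : Measurable g := measurable_integral hγ Λ₀ hfm
  have hSm : MeasurableSet {σ | r ≤ f σ - g σ} := measurableSet_le measurable_const (hfm.sub hgm)
  set B : ℝ := exp (-2 * r ^ 2 / Vc) with hB
  have hη : ∀ η : V → S, γ Λ₀ η {σ | r ≤ f σ - g σ} ≤ ENNReal.ofReal B := by
    intro η
    haveI : IsProbabilityMeasure (γ Λ₀ η) := hγ.isProbability _ η
    have hae : ∀ᵐ σ ∂(γ Λ₀ η), g σ = g η := by
      filter_upwards [hγ.proper Λ₀ η] with σ hσ
      simp only [hg]
      rw [apply_eq_of_forall_not_mem hγ Λ₀ hσ]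
    have heq : γ Λ₀ η {σ | r ≤ f σ - g σ} = γ Λ₀ η {σ | r ≤ f σ - g η} := by
      refine measure_congr ?_
      filter_upwards [hae] with σ hσ
      simp only [eq_iff_iff]
      change r ≤ f σ - g σ ↔ r ≤ f σ - g η
      rw [hσ]
    rw [heq, ← ofReal_measureReal (measure_ne_top _ _)]
    exact ENNReal.ofReal_le_ofReal (measureReal_kernel_ge_le_of_le hγ Λ₀ hfm hM hc0 hc hV hr η)
  have hle : μ {σ | r ≤ f σ - g σ} ≤ ENNReal.ofReal B := by
    rw [← hμ.2 Λ₀ _ hSm]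
    calc ∫⁻ η, γ Λ₀ η {σ | r ≤ f σ - g σ} ∂μ ≤ ∫⁻ _η, ENNReal.ofReal B ∂μ := lintegral_mono hη
      _ = ENNReal.ofReal B := by rw [lintegral_const, measure_univ, mul_one]
  exact ENNReal.toReal_le_of_le_ofReal (exp_pos _).le hle

/-- **Lower tail about the conditional expectation**, for every Gibbs measure. [folklore] -/
theorem measureReal_le_kernel_integral_le (hγ : IsSpecification γ) (Λ₀ : Finset V) {f : (V → S) → ℝ}
    (hfm : Measurable f) {M : ℝ} (hM : ∀ σ, |f σ| ≤ M) {c : V → ℝ} (hc0 : ∀ y, 0 ≤ c y)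
    (hc : ∀ Λ', Λ' ⊆ Λ₀ → ∀ y ∈ Λ₀, y ∉ Λ' → ∀ ω η : V → S, (∀ z, z ≠ y → ω z = η z) →
      |(∫ σ, f σ ∂(γ Λ' ω)) - ∫ σ, f σ ∂(γ Λ' η)| ≤ c y)
    {Vc : ℝ} (hV : ∑ y ∈ Λ₀, c y ^ 2 ≤ Vc)
    {μ : Measure (V → S)} (hμ : IsGibbsMeasure γ μ) {r : ℝ} (hr : 0 ≤ r) :
    μ.real {σ | r ≤ (∫ τ, f τ ∂(γ Λ₀ σ)) - f σ} ≤ exp (-2 * r ^ 2 / Vc) := by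
  have hc' : ∀ Λ', Λ' ⊆ Λ₀ → ∀ y ∈ Λ₀, y ∉ Λ' → ∀ ω η : V → S, (∀ z, z ≠ y → ω z = η z) →
      |(∫ σ, (-f σ) ∂(γ Λ' ω)) - ∫ σ, (-f σ) ∂(γ Λ' η)| ≤ c y := by
    intro Λ' hΛ' y hy hy' ω η hωη
    rw [integral_neg, integral_neg, ← abs_neg]
    convert hc Λ' hΛ' y hy hy' ω η hωη using 2
    ring
  have h := measureReal_ge_kernel_integral_le hγ Λ₀ hfm.neg (fun σ => by rw [Pi.neg_apply, abs_neg]; exact hM σ)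
    hc0 hc' hV hμ hr
  refine le_trans (le_of_eq ?_) h
  congr 1
  ext σ
  simp only [Set.mem_setOf_eq, Pi.neg_apply, integral_neg]
  constructor <;> intro h' <;> linarith

/-! ### Gibbs measures: concentration about the mean, given boundary closeness -/

/-- **Gaussian concentration about the mean, given boundary closeness** (Külske 2003, Thm. 1, in the form
"(boundary decay) + (McDiarmid)"): if moreover the kernels of `Λ₀` are uniformly `ε`-close to `μ` on `f`,
`|∫ f dγ_{Λ₀}(·|ω) − ∫ f dμ| ≤ ε` for every `ω` (in the uniqueness regime this is the cell's boundary-decay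
currency, `BoundaryDecay*.lean`), then `μ{f − ∫ f dμ ≥ r + ε} ≤ exp(−2 r² / Vc)` for `r ≥ 0`. [folklore] -/
theorem measureReal_ge_integral_add_le (hγ : IsSpecification γ) (Λ₀ : Finset V) {f : (V → S) → ℝ}
    (hfm : Measurable f) {M : ℝ} (hM : ∀ σ, |f σ| ≤ M) {c : V → ℝ} (hc0 : ∀ y, 0 ≤ c y)
    (hc : ∀ Λ', Λ' ⊆ Λ₀ → ∀ y ∈ Λ₀, y ∉ Λ' → ∀ ω η : V → S, (∀ z, z ≠ y → ω z = η z) →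
      |(∫ σ, f σ ∂(γ Λ' ω)) - ∫ σ, f σ ∂(γ Λ' η)| ≤ c y)
    {Vc : ℝ} (hV : ∑ y ∈ Λ₀, c y ^ 2 ≤ Vc)
    {μ : Measure (V → S)} (hμ : IsGibbsMeasure γ μ) {ε : ℝ}
    (hε : ∀ ω, |(∫ τ, f τ ∂(γ Λ₀ ω)) - ∫ τ, f τ ∂μ| ≤ ε) {r : ℝ} (hr : 0 ≤ r) :
    μ.real {σ | r + ε ≤ f σ - ∫ τ, f τ ∂μ} ≤ exp (-2 * r ^ 2 / Vc) := by
  haveI := hμ.isProbabilityMeasure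
  refine le_trans (measureReal_mono ?_) (measureReal_ge_kernel_integral_le hγ Λ₀ hfm hM hc0 hc hV hμ hr)
  intro σ hσ
  simp only [Set.mem_setOf_eq] at hσ ⊢
  have := hε σ
  linarith [(abs_le.1 this).1, (abs_le.1 this).2]

/-- **Lower tail about the mean, given boundary closeness.** [folklore] -/
theorem measureReal_le_integral_add_le (hγ : IsSpecification γ) (Λ₀ : Finset V) {f : (V → S) → ℝ}
    (hfm : Measurable f) {M : ℝ} (hM : ∀ σ, |f σ| ≤ M) {c : V → ℝ} (hc0 : ∀ y, 0 ≤ c y)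
    (hc : ∀ Λ', Λ' ⊆ Λ₀ → ∀ y ∈ Λ₀, y ∉ Λ' → ∀ ω η : V → S, (∀ z, z ≠ y → ω z = η z) →
      |(∫ σ, f σ ∂(γ Λ' ω)) - ∫ σ, f σ ∂(γ Λ' η)| ≤ c y)
    {Vc : ℝ} (hV : ∑ y ∈ Λ₀, c y ^ 2 ≤ Vc)
    {μ : Measure (V → S)} (hμ : IsGibbsMeasure γ μ) {ε : ℝ}
    (hε : ∀ ω, |(∫ τ, f τ ∂(γ Λ₀ ω)) - ∫ τ, f τ ∂μ| ≤ ε) {r : ℝ} (hr : 0 ≤ r) :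
    μ.real {σ | r + ε ≤ (∫ τ, f τ ∂μ) - f σ} ≤ exp (-2 * r ^ 2 / Vc) := by
  haveI := hμ.isProbabilityMeasure
  refine le_trans (measureReal_mono ?_) (measureReal_le_kernel_integral_le hγ Λ₀ hfm hM hc0 hc hV hμ hr)
  intro σ hσ
  simp only [Set.mem_setOf_eq] at hσ ⊢
  have := hε σ
  linarith [(abs_le.1 this).1, (abs_le.1 this).2]

/-- **Two-sided Gaussian concentration about the mean, given boundary closeness**:
`μ{|f − ∫ f dμ| ≥ r + ε} ≤ 2 exp(−2 r² / Vc)`. [folklore] -/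
theorem measureReal_abs_sub_integral_ge_le (hγ : IsSpecification γ) (Λ₀ : Finset V) {f : (V → S) → ℝ}
    (hfm : Measurable f) {M : ℝ} (hM : ∀ σ, |f σ| ≤ M) {c : V → ℝ} (hc0 : ∀ y, 0 ≤ c y)
    (hc : ∀ Λ', Λ' ⊆ Λ₀ → ∀ y ∈ Λ₀, y ∉ Λ' → ∀ ω η : V → S, (∀ z, z ≠ y → ω z = η z) →
      |(∫ σ, f σ ∂(γ Λ' ω)) - ∫ σ, f σ ∂(γ Λ' η)| ≤ c y)
    {Vc : ℝ} (hV : ∑ y ∈ Λ₀, c y ^ 2 ≤ Vc)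
    {μ : Measure (V → S)} (hμ : IsGibbsMeasure γ μ) {ε : ℝ}
    (hε : ∀ ω, |(∫ τ, f τ ∂(γ Λ₀ ω)) - ∫ τ, f τ ∂μ| ≤ ε) {r : ℝ} (hr : 0 ≤ r) :
    μ.real {σ | r + ε ≤ |f σ - ∫ τ, f τ ∂μ|} ≤ 2 * exp (-2 * r ^ 2 / Vc) := by
  haveI := hμ.isProbabilityMeasure
  have hsub : {σ | r + ε ≤ |f σ - ∫ τ, f τ ∂μ|} ⊆
      {σ | r + ε ≤ f σ - ∫ τ, f τ ∂μ} ∪ {σ | r + ε ≤ (∫ τ, f τ ∂μ) - f σ} := by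
    intro σ hσ
    simp only [Set.mem_setOf_eq, Set.mem_union] at hσ ⊢
    rcases le_or_gt 0 (f σ - ∫ τ, f τ ∂μ) with h | h
    · left; rwa [abs_of_nonneg h] at hσ
    · right; rw [abs_of_neg h] at hσ; linarith
  calc μ.real {σ | r + ε ≤ |f σ - ∫ τ, f τ ∂μ|}
      ≤ μ.real ({σ | r + ε ≤ f σ - ∫ τ, f τ ∂μ} ∪ {σ | r + ε ≤ (∫ τ, f τ ∂μ) - f σ}) :=
        measureReal_mono hsub
    _ ≤ μ.real {σ | r + ε ≤ f σ - ∫ τ, f τ ∂μ} + μ.real {σ | r + ε ≤ (∫ τ, f τ ∂μ) - f σ} :=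
        measureReal_union_le _ _
    _ ≤ exp (-2 * r ^ 2 / Vc) + exp (-2 * r ^ 2 / Vc) :=
        add_le_add (measureReal_ge_integral_add_le hγ Λ₀ hfm hM hc0 hc hV hμ hε hr)
          (measureReal_le_integral_add_le hγ Λ₀ hfm hM hc0 hc hV hμ hε hr)
    _ = 2 * exp (-2 * r ^ 2 / Vc) := by ring

/-! ### The infinite-volume form: volumes exhausting the lattice, boundary closeness tending to zero -/

/-- **Gaussian concentration about the mean in infinite volume** (Külske 2003, Thm. 1): let the single-site influences
`c ≥ 0` of `f` hold in EVERY finite volume (`|∫ f dγ_{Λ'}(·|ω) − ∫ f dγ_{Λ'}(·|η)| ≤ c y` for all finite `Λ'`, `y ∉ Λ'`,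
`ω = η` off `y`), let `Λ n` be finite volumes with variance proxies `Σ_{y ∈ Λ n} c_y² ≤ Vc` for all `n`, and let the
kernels of `Λ n` approach the Gibbs measure `μ` on `f` uniformly in the boundary condition: `|∫ f dγ_{Λ n}(·|ω) − ∫ f dμ|
≤ ε n` with `ε n → 0`. Then `μ{|f − ∫ f dμ| ≥ r} ≤ 2 exp(−2 r² / Vc)` for every `r ≥ 0`. [folklore] -/
theorem measureReal_abs_sub_integral_ge_le_of_tendsto (hγ : IsSpecification γ) {f : (V → S) → ℝ}
    (hfm : Measurable f) {M : ℝ} (hM : ∀ σ, |f σ| ≤ M) {c : V → ℝ} (hc0 : ∀ y, 0 ≤ c y)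
    (hc : ∀ (Λ' : Finset V) (y : V), y ∉ Λ' → ∀ ω η : V → S, (∀ z, z ≠ y → ω z = η z) →
      |(∫ σ, f σ ∂(γ Λ' ω)) - ∫ σ, f σ ∂(γ Λ' η)| ≤ c y)
    (Λ : ℕ → Finset V) {Vc : ℝ} (hV : ∀ n, ∑ y ∈ Λ n, c y ^ 2 ≤ Vc)
    {μ : Measure (V → S)} (hμ : IsGibbsMeasure γ μ) {ε : ℕ → ℝ}
    (hε : ∀ n ω, |(∫ τ, f τ ∂(γ (Λ n) ω)) - ∫ τ, f τ ∂μ| ≤ ε n) (hε0 : Tendsto ε atTop (𝓝 0))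
    {r : ℝ} (hr : 0 ≤ r) :
    μ.real {σ | r ≤ |f σ - ∫ τ, f τ ∂μ|} ≤ 2 * exp (-2 * r ^ 2 / Vc) := by
  haveI := hμ.isProbabilityMeasure
  have hcn : ∀ n, ∀ Λ', Λ' ⊆ Λ n → ∀ y ∈ Λ n, y ∉ Λ' → ∀ ω η : V → S, (∀ z, z ≠ y → ω z = η z) →
      |(∫ σ, f σ ∂(γ Λ' ω)) - ∫ σ, f σ ∂(γ Λ' η)| ≤ c y := fun n Λ' _ y _ hy ω η h => hc Λ' y hy ω η h
  -- for every `r' < r` with `0 ≤ r'` the bound with `r'` holds (take `n` with `ε n ≤ r − r'`)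
  have key : ∀ r', 0 ≤ r' → r' < r → μ.real {σ | r ≤ |f σ - ∫ τ, f τ ∂μ|} ≤ 2 * exp (-2 * r' ^ 2 / Vc) := by
    intro r' hr'0 hr'r
    have hev : ∀ᶠ n in atTop, ε n < r - r' := (tendsto_order.1 hε0).2 _ (by linarith)
    obtain ⟨n, hn⟩ := hev.exists
    refine le_trans (measureReal_mono fun σ hσ => ?_)
      (measureReal_abs_sub_integral_ge_le hγ (Λ n) hfm hM hc0 (hcn n) (hV n) hμ (hε n) hr'0)
    simp only [Set.mem_setOf_eq] at hσ ⊢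
    linarith
  rcases hr.eq_or_lt with h0 | hpos
  · -- `r = 0`: the bound is `≥ 2 ≥ 1`
    rw [← h0]
    calc μ.real {σ | (0 : ℝ) ≤ |f σ - ∫ τ, f τ ∂μ|} ≤ 1 := measureReal_le_one
      _ ≤ 2 * exp (-2 * (0 : ℝ) ^ 2 / Vc) := by norm_num
  · -- `r > 0`: let `r' ↑ r`
    have hcont : Tendsto (fun r' : ℝ => 2 * exp (-2 * r' ^ 2 / Vc)) (𝓝[<] r) (𝓝 (2 * exp (-2 * r ^ 2 / Vc))) := by
      have h : Continuous fun r' : ℝ => 2 * exp (-2 * r' ^ 2 / Vc) := by fun_prop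
      exact (h.tendsto r).mono_left nhdsWithin_le_nhds
    refine ge_of_tendsto hcont ?_
    have hev : ∀ᶠ r' in 𝓝[<] r, 0 < r' := by
      have : Set.Ioo 0 r ∈ 𝓝[<] r := Ioo_mem_nhdsLT hpos
      filter_upwards [this] with r' hr'
      exact hr'.1
    filter_upwards [hev, self_mem_nhdsWithin] with r' hr'0 hr'r
    exact key r' hr'0.le hr'r

end SpecConcentration

end Summit.Ventures.YMGap.RobustBall

end
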